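import Mathlib
import HarnessLib
import Summits.ValiantsHypothesis.ValiantsHypothesis.Theses.MonotoneRestoration
import Literature.Computability.AlgebraicComplexity.ArithCircuit
import Literature.Computability.AlgebraicComplexity.ArithCircuitProofs
import Literature.Computability.AlgebraicComplexity.MonotoneStructure
import Literature.Computability.AlgebraicComplexity.PermanentIrreducible
import Literature.ModelTheory.FiniteModelTheory.CkEquiv
import Summits.ValiantsHypothesis.ValiantsHypothesis.Theorems.MonotoneRestorationMonotoneRestorationQPCosetCount
import Summits.ValiantsHypothesis.ValiantsHypothesis.Theorems.MonotoneRestorationMonotoneRestorationQPSymmetricLB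
import Summits.ValiantsHypothesis.ValiantsHypothesis.Theorems.MonotoneRestorationMonotoneRestorationQPSupportSymmetrisation
import Summits.ValiantsHypothesis.ValiantsHypothesis.Theorems.MonotoneRestorationMonotoneRestorationQPSparseRegime
import Summits.ValiantsHypothesis.ValiantsHypothesis.Theorems.MonotoneRestorationMonotoneRestorationQPBeta
import Literature.Computability.AlgebraicComplexity.SymmetricArithCircuit
import Literature.Computability.AlgebraicComplexity.DawarWilsenach2025Proofs
import Literature.GroupTheory.PermutationGroups.SmallIndexSubgroups
import Summits.ValiantsHypothesis.ValiantsHypothesis.Theorems.MonotoneRestorationQP.Negative.LoadBearing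
import Summits.ValiantsHypothesis.ValiantsHypothesis.Theorems.MonotoneRestorationMonotoneRestorationQPPermSupportCount

/-! TTRL-lite variant V20202 of stmt-ValiantsHypothesis-15886 -/

-- `Summit.ValiantsHypothesis.ValiantsHypothesis.…` is the tree's mandated single-conjunct layout
-- (Sub = Summit), so the duplicated namespace component is intended.
set_option linter.dupNamespace false

namespace Summit.ValiantsHypothesis.ValiantsHypothesis.Theorems

open Summit.ValiantsHypothesis.ValiantsHypothesis.Theses.MonotoneRestoration
open Literature.Computability.AlgebraicComplexity

/-- Evaluation of the row-sum substitution of the elementary symmetric polynomial factors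
through the row sums: `eval x (e_k(R₀, …, R_{n-1})) = e_k(Σ_j x_{0j}, …, Σ_j x_{(n-1)j})`
where `R_i = Σ_j X_{ij}` (Mathlib's `eval₂Hom_bind₁` for the identity ring map, plus
`map_sum`/`eval_X`). TTRL-lite variant V20202 of `stub_esymmRowSums_structure`. -/
theorem stub_esymmRowSums_structure_var20202 :
    ∀ (n k : ℕ) (x : Fin n × Fin n → NNReal),
      MvPolynomial.eval x (MvPolynomial.bind₁ (fun i : Fin n => ∑ j : Fin n,
        MvPolynomial.X (i, j)) (MvPolynomial.esymm (Fin n) NNReal k)) =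
      MvPolynomial.eval (fun i : Fin n => ∑ j : Fin n, x (i, j))
        (MvPolynomial.esymm (Fin n) NNReal k) := by
  intro n k x
  rw [show MvPolynomial.eval x (MvPolynomial.bind₁ (fun i : Fin n => ∑ j : Fin n,
        MvPolynomial.X (i, j)) (MvPolynomial.esymm (Fin n) NNReal k)) =
      MvPolynomial.eval (fun i : Fin n => MvPolynomial.eval x (∑ j : Fin n,
        (MvPolynomial.X (i, j) : MvPolynomial (Fin n × Fin n) NNReal)))
        (MvPolynomial.esymm (Fin n) NNReal k) from MvPolynomial.eval₂Hom_bind₁ _ _ _ _]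
  simp only [map_sum, MvPolynomial.eval_X]

end Summit.ValiantsHypothesis.ValiantsHypothesis.Theorems
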